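import Summits.QuantumFields.BalabanUV.Beta.D1BFx.AssemblyEndRecut
import Summits.QuantumFields.BalabanUV.Beta.D1BFx.FrozenLegProfile
import Summits.QuantumFields.BalabanUV.Beta.D1BFx.RoadEnd

/-!
# Road BF-x, END-TO-END OVER THE RE-CUT REST TABLE AT THE ROAD'S FROZEN PROFILE OF RECORD: `D1Drift Lc Js N μ ν` from the road's NAMED
# remaining inputs — h0∕h1∕hg∕hgev, (CONV), the corner word, `hrow`∕`hT1` NO LONGER AMONG THEM

Owner file of road «BF-x» (BINDER-OWNERS row D1, co-owner d1-p2, gen 3).  The twin of `RoadEndBFx.d1Drift_BFx` (p222356) after the owner's RESHAPE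
(FINDING «D1-BFx-LON-MISCUT», journal 2026-08-20 15:31:53Z) and INTEGRATION #8 of the swarm's landings:

* the REST words are the RE-CUT table `SplitRecut.restK'` (Feynman-completed sectors; no longitudinal word) — `AssemblyEndRecut.defect_le_at_recut`;
* the frozen profile IS the road's `gfrz n a` (R-10′, leaf-03-g3 `FrozenLegProfile` p221057): its window rows h0∕h1 (`abs_gfrz_sub_gFree_le`,
  `abs_gfrz_diff_flat_le` — UNCONDITIONAL), its exponential bound (`decay_gfrz` ⟸ `Spr (Ga n a)`), its evenness (`gfrz_neg`) and its axis-reflection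
  invariance (`gfrz_negAt`) are THEOREMS, no longer hypotheses;
* the normalisation `lam n := n⁸` is PINNED (it is forced by the corner word anyway), so the corner word's (REST) bound is `CornerRest.rest_corner_bound`
  + leaf-03-g4's `CornerSummable.summable_weight₂_bfKernel`∕`summable_weight₁_bfKernel` — a THEOREM; (K)'s normalisation reads `ω_gl n·cE n² = 2N²·n⁸`;
* (CONV) for every rest word is `AssemblyEndRecut.conv_recut` — no `hKr`;
* K-R5's `hrow` + `hT1` are replaced by the single first-bond divergence-freeness datum `hdiv` (gan24-leaf-05-g31 `FineHessianWardKroneckerBlock`).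

`d1Drift_BFx_recut` therefore DISPLAYS, by name and nothing else, what the BF-x road still owes for the wall conjunct (D1) in the strong grading
(odd blocking factor `Lc ≥ 2`): B1 `hB1`; (K) `hK` + `hω` + `hlam`; the (α)-leaf `Spr (Ga n a)` (B5 Prop. 1.2 content); the five slot-table sockets;
`hdiv`; the ghost Ward rows `hrowgh`; the frozen profile's FAR rows h2∕d0∕d1∕d2 (B5 Prop. 1.2 content again); (REST′) per-word n-UNIFORM bounds for
the re-cut words EXCEPT the corner; (U).  HONEST STATUS: composition [folklore]; no cited facts; D1 NOT discharged — every bullet is an OPEN hypothesis.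
HONEST DEPENDENCY: continuum YM on T⁴ ⇐ BetaPertH ∧ nine spine estimates (0/9 proved); BetaPertH ⇐ (D1) ∧ (D4) ∧ CAP+tail; G-an2-4 gates asym,
D1 and NE2/3/4.
-/

noncomputable section

open Finset Filter Topology
open scoped BigOperators
open Literature.MathematicalPhysics.QuantumFieldTheory.Balaban1983to89
open Literature.MathematicalPhysics.QuantumFieldTheory.Balaban1983to89.Beta
open OneStepResolventKernel (JetData)
open OneStepKernelFamily (TbalOf D1Drift)
open WindowIdentification (fullSum psum)
open B12Sec2to5 (l1)
open DyadicShell (Pt toReal supNorm)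
open ExpKernelCalculus (Site MKer BiLoc shiftK)
open SquareTable (stK)
open GhostTable (gFree)
open SpinTable (bfKernel)
open BubbleTransfer (unitVec)
open DressedMomentNormalisation (resSite)
open LongitudinalWindow (ellD0 ellD1)
open WoodburyCovariant (woodburyDc woodburyD1c)
open Summit.QuantumFields.BalabanUV.Beta.TameKernelCalculus (Spr)
open Summit.QuantumFields.BalabanUV.Beta.D1BFx.GluonLeg (Ga)
open Summit.QuantumFields.BalabanUV.Beta.D1BFx.ReducedKernel (TableR TOfRed)
open Summit.QuantumFields.BalabanUV.Beta.D1BFx.DressedTadpoleTable (tableRed)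
open Summit.QuantumFields.BalabanUV.Beta.D1BFx.ReducedKernelSandwich (fineHess)
open Summit.QuantumFields.BalabanUV.Beta.D1BFx.FineStencilBFBalaban (SbfBal)
open Summit.QuantumFields.BalabanUV.Beta.D1BFx.SecondStencilBF (Wbf)
open Summit.QuantumFields.BalabanUV.Beta.D1BFx.GhostKernelComplete (PghQ fineHessGhQ)
open Summit.QuantumFields.BalabanUV.Beta.D1BFx.FrozenCorner (negAt)
open Summit.QuantumFields.BalabanUV.Beta.D1BFx.FrozenLegProfile (gfrz gfrz_neg gfrz_negAt decay_gfrz abs_gfrz_sub_gFree_le abs_gfrz_diff_flat_le)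
open Summit.QuantumFields.BalabanUV.Beta.D1BFx.SplitInstance (RestIdx restK)
open Summit.QuantumFields.BalabanUV.Beta.D1BFx.SplitRecut (restK' restK'_corner_eq)
open Summit.QuantumFields.BalabanUV.Beta.D1BFx.CornerRest (rest_corner_bound)
open Summit.QuantumFields.BalabanUV.Beta.D1BFx.CornerSummable (summable_weight₂_bfKernel summable_weight₁_bfKernel)
open Summit.QuantumFields.BalabanUV.Beta.D1BFx.Assembly (sum_uniform_resSite)
open Summit.QuantumFields.BalabanUV.Beta.D1BFx.AssemblyEnd (hT_of_pointwise)
open Summit.QuantumFields.BalabanUV.Beta.D1BFx.AssemblyEndRecut (defect_le_at_recut)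
open Summit.QuantumFields.BalabanUV.Beta.D1BFx.RoadEnd (d1Drift_of_strongRoad)

namespace Summit.QuantumFields.BalabanUV.Beta.D1BFx.RoadEndBFxRecut

/-! ## §1 The corner index, the window constants, the profile family as a total function of the block size -/

/-- [our object] THE INDEX OF THE CORNER WORD in `SplitInstance.RestIdx`. -/
def cornerIdx : RestIdx := Sum.inr (Sum.inr (Sum.inr (Sum.inr 0)))

/-- [our object] THE WINDOW CONSTANTS OF THE FROZEN PROFILE: `0 ↦ woodburyDc 0 + ellD0 4 a` (h0), `1 ↦ woodburyD1c 0 + ellD1 4 a` (h1), else the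
displayed far constant `D₂` (h2). -/
def rowConst (a D₂ : ℝ) : ℕ → ℝ
  | 0 => woodburyDc 0 + ellD0 4 a
  | 1 => woodburyD1c 0 + ellD1 4 a
  | _ => D₂

/-- [our object] THE FROZEN PROFILE FAMILY AS A TOTAL FUNCTION OF THE BLOCK SIZE (`0` at `n = 0`, where the road never evaluates it). -/
def gfrz₀ (a : ℝ) (n : ℕ) (b v : Pt) : ℝ := if h : n = 0 then 0 else @gfrz n ⟨h⟩ a b v

/-- [our object] At a positive block size the total family IS `gfrz n a`. -/
theorem gfrz₀_eq (a : ℝ) (n : ℕ) [NeZero n] : gfrz₀ a n = gfrz n a := by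
  funext b v
  rw [gfrz₀, dif_neg (NeZero.ne n)]

/-- [folklore] The window-h0 constant of the frozen profile is nonnegative (it bounds an absolute value at `n = 1`). -/
theorem rowConst₀_nonneg {a : ℝ} (ha : 0 < a) : 0 ≤ woodburyDc 0 + ellD0 4 a := by
  have h := abs_gfrz_sub_gFree_le 1 le_rfl ha 0 0
  rw [Nat.cast_one, one_pow, div_one] at h
  exact (abs_nonneg _).trans h

/-- [folklore] The window-h1 constant of the frozen profile is nonnegative. -/
theorem rowConst₁_nonneg {a : ℝ} (ha : 0 < a) : 0 ≤ woodburyD1c 0 + ellD1 4 a := by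
  have h := abs_gfrz_diff_flat_le 1 le_rfl ha 0 0 0
  rw [Nat.cast_one, one_pow, div_one] at h
  exact (abs_nonneg _).trans h

/-- [folklore] Every window constant is nonnegative once the far one is. -/
theorem rowConst_nonneg {a D₂ : ℝ} (ha : 0 < a) (hD₂ : 0 ≤ D₂) : ∀ j, 0 ≤ rowConst a D₂ j
  | 0 => rowConst₀_nonneg ha
  | 1 => rowConst₁_nonneg ha
  | (_ + 2) => hD₂

/-! ## §2 (REST′) for every re-cut word from the off-corner words: the corner word is a theorem -/

section Rest

variable (n : ℕ) [NeZero n] (a : ℝ) (cE cΛ cR cK cQ cE₂ cJ4 cΛ₂ cR₂ cQ₂ x₀ ωgl ωgh N : ℝ) (WE WJ WΛ WR WQ : TableR) {μ ν : Fin 4} {CR : RestIdx → ℝ}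

/-- [folklore] **THE (REST′) BOUNDS FOR ALL RE-CUT WORDS FROM THE OFF-CORNER ONES** at the pinned normalisation `lam = n⁸` and the frozen profile
`gfrz n a`: the corner word's base-point average has full sum `0` (`CornerRest.rest_corner_bound` + `FrozenLegProfile.gfrz_negAt` + leaf-03-g4's
`CornerSummable` summabilities ⟸ `Spr (Ga n a)`), so its constant is `0`. -/
theorem rest_all_of_offCorner (hμν : μ ≠ ν) (hGa : Spr (Ga n a))
    (hRest : ∀ τ : RestIdx, τ ≠ cornerIdx →
      |∑ b ∈ (univ : Finset (Fin 4 → Fin n)).image resSite, ((n : ℝ) ^ 4)⁻¹ *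
        fullSum (fun w : Pt => restK' n a (gfrz n a b) cE cΛ cR cK cQ cE₂ cJ4 cΛ₂ cR₂ cQ₂ x₀ WE WJ WΛ WR WQ ωgl ωgh ((n : ℝ) ^ 8) N μ ν b τ w)|
        ≤ CR τ) (τ : RestIdx) :
    |∑ b ∈ (univ : Finset (Fin 4 → Fin n)).image resSite, ((n : ℝ) ^ 4)⁻¹ *
        fullSum (fun w : Pt => restK' n a (gfrz n a b) cE cΛ cR cK cQ cE₂ cJ4 cΛ₂ cR₂ cQ₂ x₀ WE WJ WΛ WR WQ ωgl ωgh ((n : ℝ) ^ 8) N μ ν b τ w)|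
      ≤ (if τ = cornerIdx then 0 else CR τ) := by
  by_cases hτ : τ = cornerIdx
  · rw [if_pos hτ, hτ, cornerIdx]
    simp only [restK'_corner_eq]
    have hn8 : ((n : ℝ) ^ 8)⁻¹ * (n : ℝ) ^ 8 = 1 := inv_mul_cancel₀ (pow_ne_zero 8 (Nat.cast_ne_zero.mpr (NeZero.ne n)))
    refine rest_corner_bound n a (gb := fun b => gfrz n a b) cE cΛ cR cK cQ cE₂ cJ4 cΛ₂ cR₂ cQ₂ x₀ WE WJ WΛ WR WQ ωgl ωgh ((n : ℝ) ^ 8) N hμν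
      (fun b w => gfrz_negAt μ w) (fun b => ?_) (fun b => ?_) hn8
    · obtain ⟨C, δ', hδ', hgb⟩ := decay_gfrz hGa b
      exact summable_weight₂_bfKernel hδ' hgb N μ ν μ ν
    · obtain ⟨C, δ', hδ', hgb⟩ := decay_gfrz hGa b
      exact summable_weight₁_bfKernel hδ' hgb N μ ν ν
  · rw [if_neg hτ]
    exact hRest τ hτ

end Rest

/-! ## §3 The road END over the re-cut table at the frozen profile of record -/

variable {Lc : ℕ} [NeZero Lc] {a N : ℝ} {μ ν : Fin 4} {υ : Type*} [Fintype υ]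
  {cE cVH cΛ cR cK cQ cE₂ cJ4 cΛ₂ cR₂ cQ₂ x₀ ωgl ωgh : ℕ → ℝ} {WE WJ WΛ WR WQ : ℕ → TableR} {CE CJ CΛ CRt CQ δW : ℕ → ℝ}
  {Ru : υ → ℕ → ℝ} {CU : υ → ℝ} {CR : RestIdx → ℝ} {A : ℕ → ℝ} {D₂ δ U₁ : ℝ}

/-- [folklore] **ROAD BF-x, END TO END, OVER THE RE-CUT REST TABLE AT THE FROZEN PROFILE `gfrz` (strong grading, odd blocking factor).**  The wall's
literal term `D1Drift Lc Js N μ ν` for ANY jet data `Js`, channel `μ ≠ ν`, `N ≠ 0`, from: bridge B1; the kernel representation (K) of the one-shot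
coefficient with the loop-weight ratio `ω_gh·cK² = −2·ω_gl·cE²` and the normalisation `ω_gl·cE² = 2N²·n⁸`; the (α)-leaf `Spr (Ga n a)`; the slot-table
sockets; the first-bond divergence-freeness `hdiv` of the gluon fine Hessian kernel; the ghost Ward rows; the FAR rows h2∕d0∕d1∕d2 of `gfrz`; the per-word
n-UNIFORM (REST′) bounds for the re-cut words other than the corner; (U).  The near rows h0∕h1, the profile's exponential bound, evenness and
`R_μ`-invariance, (CONV) for every word and the corner word's bound are THEOREMS used inside. -/
theorem d1Drift_BFx_recut (Js : ℕ → JetData 3 Lc) (hμν : μ ≠ ν) (hN : N ≠ 0) (hL : 2 ≤ Lc) (hodd : Odd Lc) (ha : 0 < a) (c : ℕ → ℝ)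
    (hD₂ : 0 ≤ D₂) (hA : ∀ j, 0 ≤ A j) (hδ : 0 < δ)
    -- the frozen profile's FAR rows (B5 Prop. 1.2 content)
    (h2 : ∀ n : ℕ, 2 ≤ n → ∀ [NeZero n], ∀ b ∈ (univ : Finset (Fin 4 → Fin n)).image resSite, ∀ v,
      |(gfrz n a b (v + unitVec ν + unitVec μ) - gFree (v + unitVec ν + unitVec μ)) - (gfrz n a b (v + unitVec ν) - gFree (v + unitVec ν)) -
          (gfrz n a b (v + unitVec μ) - gFree (v + unitVec μ)) + (gfrz n a b v - gFree v)| ≤ D₂ / (n : ℝ) ^ 4)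
    (d0 : ∀ n : ℕ, 2 ≤ n → ∀ [NeZero n], ∀ b ∈ (univ : Finset (Fin 4 → Fin n)).image resSite, ∀ v : Pt, v ≠ 0 →
      |gfrz n a b v| ≤ A 0 * Real.exp (-(δ / n) * supNorm v) / (supNorm v : ℝ) ^ 2)
    (d1 : ∀ n : ℕ, 2 ≤ n → ∀ [NeZero n], ∀ b ∈ (univ : Finset (Fin 4 → Fin n)).image resSite, ∀ v : Pt, v ≠ 0 → ∀ ρ : Fin 4,
      |gfrz n a b (v + unitVec ρ) - gfrz n a b v| ≤ A 1 * Real.exp (-(δ / n) * supNorm v) / (supNorm v : ℝ) ^ 3)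
    (d2 : ∀ n : ℕ, 2 ≤ n → ∀ [NeZero n], ∀ b ∈ (univ : Finset (Fin 4 → Fin n)).image resSite, ∀ v : Pt, v ≠ 0 →
      |gfrz n a b (v + unitVec ν + unitVec μ) - gfrz n a b (v + unitVec ν) - gfrz n a b (v + unitVec μ) + gfrz n a b v| ≤
        A 2 * Real.exp (-(δ / n) * supNorm v) / (supNorm v : ℝ) ^ 4)
    -- bridge B1
    (hB1 : ∀ m : ℕ, 1 ≤ m → |(∑ j ∈ range m, B12Beta.secondMoment (TbalOf Lc Js j) μ ν) - c (Lc ^ m)| ≤ U₁)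
    -- the (α)-leaf and slot (K) with the loop-weight ratio and the PINNED normalisation
    (hGa : ∀ n : ℕ, 2 ≤ n → ∀ [NeZero n], Spr (Ga n a))
    (hK : ∀ n : ℕ, 2 ≤ n → Odd n → ∀ [NeZero n], c n =
      ωgl n * B12Beta.secondMoment (TOfRed n a (SbfBal n a (cE n) (cVH n) (cΛ n) (cR n) (cK n) (cQ n))
        (tableRed n (Wbf (cE₂ n) (cJ4 n) (cΛ₂ n) (cR₂ n) (cQ₂ n) (WE n) (WJ n) (WΛ n) (WR n) (WQ n)))) μ ν
      + ωgh n * B12Beta.secondMoment (PghQ n a (x₀ n) (cK n) (cQ n)) μ ν + ∑ u, Ru u n)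
    (hω : ∀ n : ℕ, 2 ≤ n → ωgh n * cK n ^ 2 = -2 * (ωgl n * cE n ^ 2)) (hlam : ∀ n : ℕ, 2 ≤ n → ωgl n * cE n ^ 2 = 2 * N ^ 2 * (n : ℝ) ^ 8)
    -- slot-table sockets
    (hδW : ∀ n, 0 < δW n)
    (hE : ∀ n κ u l u', BiLoc (WE n κ u l u') u u' (CE n) (δW n)) (hJ : ∀ n κ u l u', BiLoc (WJ n κ u l u') u u' (CJ n) (δW n))
    (hΛ : ∀ n κ u l u', BiLoc (WΛ n κ u l u') u u' (CΛ n) (δW n)) (hR : ∀ n κ u l u', BiLoc (WR n κ u l u') u u' (CRt n) (δW n))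
    (hQ : ∀ n κ u l u', BiLoc (WQ n κ u l u') u u' (CQ n) (δW n))
    (hEc : ∀ (n : ℕ) (κ : Fin 4) (u : Site 4) (l : Fin 4) (u' t : Site 4),
      WE n κ (u + (n : ℤ) • t) l (u' + (n : ℤ) • t) = shiftK (-((n : ℤ) • t)) (WE n κ u l u'))
    (hJc : ∀ (n : ℕ) (κ : Fin 4) (u : Site 4) (l : Fin 4) (u' t : Site 4),
      WJ n κ (u + (n : ℤ) • t) l (u' + (n : ℤ) • t) = shiftK (-((n : ℤ) • t)) (WJ n κ u l u'))
    (hΛc : ∀ (n : ℕ) (κ : Fin 4) (u : Site 4) (l : Fin 4) (u' t : Site 4),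
      WΛ n κ (u + (n : ℤ) • t) l (u' + (n : ℤ) • t) = shiftK (-((n : ℤ) • t)) (WΛ n κ u l u'))
    (hRc : ∀ (n : ℕ) (κ : Fin 4) (u : Site 4) (l : Fin 4) (u' t : Site 4),
      WR n κ (u + (n : ℤ) • t) l (u' + (n : ℤ) • t) = shiftK (-((n : ℤ) • t)) (WR n κ u l u'))
    (hQc : ∀ (n : ℕ) (κ : Fin 4) (u : Site 4) (l : Fin 4) (u' t : Site 4),
      WQ n κ (u + (n : ℤ) • t) l (u' + (n : ℤ) • t) = shiftK (-((n : ℤ) • t)) (WQ n κ u l u'))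
    (hEs : ∀ n κ u l u', WE n κ u l u' = WE n l u' κ u) (hJs : ∀ n κ u l u', WJ n κ u l u' = WJ n l u' κ u)
    (hΛs : ∀ n κ u l u', WΛ n κ u l u' = WΛ n l u' κ u) (hRs : ∀ n κ u l u', WR n κ u l u' = WR n l u' κ u)
    (hQs : ∀ n κ u l u', WQ n κ u l u' = WQ n l u' κ u)
    -- first-bond divergence-freeness of the gluon fine Hessian kernel; the ghost Ward rows
    (hdiv : ∀ n : ℕ, 2 ≤ n → ∀ [NeZero n], ∀ (l' : Fin 4) (u' u : Site 4), ∑ κ' : Fin 4,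
      (fineHess n a (SbfBal n a (cE n) (cVH n) (cΛ n) (cR n) (cK n) (cQ n))
          (Wbf (cE₂ n) (cJ4 n) (cΛ₂ n) (cR₂ n) (cQ₂ n) (WE n) (WJ n) (WΛ n) (WR n) (WQ n)) κ' l' (u - Pi.single κ' 1) u'
        - fineHess n a (SbfBal n a (cE n) (cVH n) (cΛ n) (cR n) (cK n) (cQ n))
          (Wbf (cE₂ n) (cJ4 n) (cΛ₂ n) (cR₂ n) (cQ₂ n) (WE n) (WJ n) (WΛ n) (WR n) (WQ n)) κ' l' u u') = 0)
    (hrowgh : ∀ n : ℕ, 2 ≤ n → ∀ [NeZero n], ∀ (κ' l' : Fin 4) (b : Site 4), HasSum (fineHessGhQ n a (x₀ n) (cK n) (cQ n) κ' l' b) 0)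
    -- (REST′) for the re-cut words other than the corner, n-UNIFORM; (U)
    (hRest : ∀ n : ℕ, 2 ≤ n → ∀ [NeZero n], ∀ τ : RestIdx, τ ≠ cornerIdx →
      |∑ b ∈ (univ : Finset (Fin 4 → Fin n)).image resSite, ((n : ℝ) ^ 4)⁻¹ *
        fullSum (fun w : Pt => restK' n a (gfrz n a b) (cE n) (cΛ n) (cR n) (cK n) (cQ n) (cE₂ n) (cJ4 n) (cΛ₂ n) (cR₂ n) (cQ₂ n) (x₀ n)
          (WE n) (WJ n) (WΛ n) (WR n) (WQ n) (ωgl n) (ωgh n) ((n : ℝ) ^ 8) N μ ν b τ w)| ≤ CR τ)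
    (hU : ∀ n : ℕ, 2 ≤ n → ∀ u, |Ru u n| ≤ CU u) :
    D1Drift Lc Js N μ ν := by
  refine d1Drift_of_strongRoad Js hμν hN hL c (Bset := fun n => (univ : Finset (Fin 4 → Fin n)).image resSite)
    (wt := fun n _ => ((n : ℝ) ^ 4)⁻¹) (Gf := gfrz₀ a) (U₂ := (∑ u, CU u) + ∑ τ : RestIdx, (if τ = cornerIdx then 0 else CR τ))
    (D := rowConst a D₂) (A := A) (δ := δ)
    (rowConst_nonneg ha hD₂) hA hδ (fun n _ _ _ => by positivity) (fun n hn => sum_uniform_resSite (by omega)) ?_ ?_ ?_ ?_ ?_ ?_ hB1 ?_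
  · -- h0, UNCONDITIONAL
    intro n hn b _ v
    haveI : NeZero n := ⟨by omega⟩
    rw [gfrz₀_eq a n]
    exact abs_gfrz_sub_gFree_le n (le_trans one_le_two hn) ha b v
  · -- h1, UNCONDITIONAL
    intro n hn b _ v ρ
    haveI : NeZero n := ⟨by omega⟩
    rw [gfrz₀_eq a n]
    exact abs_gfrz_diff_flat_le n (le_trans one_le_two hn) ha b v ρ
  · -- h2
    intro n hn b hb v
    haveI : NeZero n := ⟨by omega⟩
    rw [gfrz₀_eq a n]
    exact h2 n hn b hb v
  · intro n hn b hb v hv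
    haveI : NeZero n := ⟨by omega⟩
    rw [gfrz₀_eq a n]
    exact d0 n hn b hb v hv
  · intro n hn b hb v hv ρ
    haveI : NeZero n := ⟨by omega⟩
    rw [gfrz₀_eq a n]
    exact d1 n hn b hb v hv ρ
  · intro n hn b hb v hv
    haveI : NeZero n := ⟨by omega⟩
    rw [gfrz₀_eq a n]
    exact d2 n hn b hb v hv
  -- the road's target `hT` along `n = Lc^m`
  refine hT_of_pointwise (c := c)
    (F := fun n => ∑ b ∈ (univ : Finset (Fin 4 → Fin n)).image resSite, ((n : ℝ) ^ 4)⁻¹ * fullSum (stK μ ν N (gfrz₀ a n b)))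
    (U := (∑ u, CU u) + ∑ τ : RestIdx, (if τ = cornerIdx then 0 else CR τ)) (fun n hn hon => ?_) hL hodd
  haveI : NeZero n := ⟨by omega⟩
  rw [gfrz₀_eq a n]
  exact defect_le_at_recut n a (cE n) (cVH n) (cΛ n) (cR n) (cK n) (cQ n) (cE₂ n) (cJ4 n) (cΛ₂ n) (cR₂ n) (cQ₂ n) (x₀ n) (ωgl n) (ωgh n)
    ((n : ℝ) ^ 8) N (gp := gfrz n a) hn hon ha hμν (hGa n hn) (hK n hn hon) (hω n hn) (hlam n hn) (hδW n) (hE n) (hJ n) (hΛ n) (hR n)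
    (hQ n) (hEc n) (hJc n) (hΛc n) (hRc n) (hQc n) (hEs n) (hJs n) (hΛs n) (hRs n) (hQs n) (hdiv n hn) (hrowgh n hn)
    (fun b => decay_gfrz (hGa n hn) b) (fun b w => gfrz_neg w)
    (rest_all_of_offCorner n a (cE n) (cΛ n) (cR n) (cK n) (cQ n) (cE₂ n) (cJ4 n) (cΛ₂ n) (cR₂ n) (cQ₂ n) (x₀ n) (ωgl n) (ωgh n) N
      (WE n) (WJ n) (WΛ n) (WR n) (WQ n) hμν (hGa n hn) (hRest n hn)) (hU n hn)

end Summit.QuantumFields.BalabanUV.Beta.D1BFx.RoadEndBFxRecut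

end
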